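import Literature.Topology.FourManifolds.BoundaryGluingRelHomology
import Literature.Topology.FourManifolds.CobordismEndOrientations
import Literature.Topology.FourManifolds.ClosedModelCollarCone
import Literature.Topology.FourManifolds.InteriorConnected
import Literature.Topology.FourManifolds.IntersectionLatticeOrientationIffProofs
import Literature.Topology.FourManifolds.TubularSplitting
import Literature.AlgebraicTopology.SingularHomology.BoundaryClassGenerator
import Literature.AlgebraicTopology.SingularHomology.FundamentalClassProofs
import HarnessLib

/-!
# A closed manifold glued from two oriented pieces along a connected boundary is orientable

Topic `Literature/Topology/FourManifolds` (boundary gluings `P = M ∪_φ N`,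
`BoundaryGluingData.lean`, `BoundaryGluingRelHomology.lean`).  Written for the Seiberg–Witten
leaf `Literature.Barriers.SmoothPoincare4.akhmedovPark2010_lemma8_invariants` (A. Akhmedov,
B. D. Park, Invent. Math. 181 (2010) 577–603, Lemma 8), whose tube-coordinate reduction
`akhmedovPark2010_lemma8_invariants_of_tube_fibreSums`
(`SmallExoticaFrontierReductionLemma8Proofs.lean`, §11) takes ORIENTATIONS of the two
torus-surgered building blocks `Y₁(1,1)` (from `Σ₂ × T²`) and `Z''(1,m)` (from `T⁴ # ℂℙ²bar`) as
hypotheses: the blocks are obtained from oriented closed `4`-manifolds by regluing a tube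
`T² × D²`, and "the result of a torus surgery on an oriented `4`-manifold is an oriented
`4`-manifold" (R. Gompf, A. Stipsicz, *4-Manifolds and Kirby Calculus* (1999), §8.3, p. 311,
logarithmic transformations; R. Fintushel, R. Stern, *Knots, links and 4-manifolds*, Invent.
Math. 134 (1998), §1).  The general statement is the homological folklore

> if `M`, `N` are compact oriented `(m+2)`-manifolds with boundary (relative fundamental classes
> `[M, ∂M]`, `[N, ∂N]`, Hatcher 2002, p. 253), `∂M` is connected and nonempty, and the closed
> connected `P = M ∪_φ N` is glued along the whole boundaries, then `P` is `ℤ`-orientable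

(Hatcher, *Algebraic Topology* (2002), §3.3: Thm. 3.26(b) "`Hₙ(M; ℤ) = 0` if `M` is
non-orientable", p. 253 and Exercise 31–32 (relative fundamental classes, gluing); Bredon,
*Topology and Geometry* (1993), VI.9 Ex. 3).  Everything here is PROVED; there are no
definitions and no named facts:

* `BoundaryGluingData.isOrientableOver_int_of_isRelFundamentalClass` — the statement above.
  Proof: in the exact sequence of the pair `(P, jA M)`,
  `Hₘ₊₂(P) → Hₘ₊₂(P, jA M) →∂ Hₘ₊₁(jA M)`, the class `b = jB_*[N, ∂N]` is nonzero (`jB_*` is an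
  isomorphism, `isIso_map_jB_boundary'`, and `[N, ∂N] ≠ 0`); its boundary is the image under
  `∂M ↪ M ≅ jA M` of the transport `u` of `∂[N, ∂N]` along the homeomorphism `∂N ≅ ∂M` of the
  seam, a local generator everywhere (Spanier, *Algebraic Topology* (1981), Cor. 6.3.10, the
  tree's `isGenerator_toLocal_δ_of_isRelFundamentalClass'`), hence `u = ±∂[M, ∂M]` on the
  connected closed manifold `∂M` (Hatcher Thm. 3.26,
  `eq_fundamentalClass_or_eq_neg_of_isGenerator_toLocal` for the boundary orientation
  `boundaryOrientation`), and `∂[M, ∂M] ↦ 0` in `Hₘ₊₁(M)` (exactness); so `∂b = 0`, `b` lifts to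
  a NONZERO class of `Hₘ₊₂(P; ℤ)`, and `P` is `ℤ`-orientable by Hatcher Thm. 3.26(b)
  (`isOrientableOver_int_of_ne_zero`).
* `BoundaryGluingData.isOrientableOver_int_of_isOrientable`, `…_of_smoothOrientation` — the same
  from SMOOTH orientability of the two pieces (Bredon VI.7.15: a smooth orientation integrates
  to `[W, ∂W]`, the tree's `NullCobordism.exists_isRelFundamentalClass_of_smoothOrientation`),
  and `BoundaryGluingData.connectedSpace` (`P` is connected when the pieces are and the boundary
  is nonempty).
* In TUBE COORDINATES (`TubularSplitting.lean`: a tube `T : F × ℝ² → Y` with tube function `g`,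
  tube piece `{g ≤ ¼} ≅ F × D̄²`, complement `{¼ ≤ g}`):
  `isOrientableOver_int_of_tube_surgery` (regluing the complement of a tube in an ORIENTABLE
  closed connected `4`-manifold with any smoothly orientable compact piece gives an orientable
  closed `4`-manifold), `isOrientableOver_int_of_tube_regluing` (**torus surgery preserves
  orientability**: the reglued piece is the tube piece itself, along any identification of the
  boundary `F × S¹`), `isOrientableOver_int_of_tube_fibreSum` (**the generalised fibre sum of two
  orientable closed `4`-manifolds along tubes is orientable**).

## References

* A. Hatcher, *Algebraic Topology*, CUP 2002, §3.3: Thm. 3.26, Lemma 3.27, p. 253,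
  Exercises 31–32. [HatcherAT2002]
* E. H. Spanier, *Algebraic Topology*, Springer 1981, Ch. 6 §3, Cor. 10. [Spanier1981]
* G. E. Bredon, *Topology and Geometry*, GTM 139, Springer 1993, VI.7.15, VI.9. [Bredon1993]
* R. E. Gompf, A. I. Stipsicz, *4-Manifolds and Kirby Calculus*, GSM 20, AMS 1999, §8.3 p. 311.
  [GompfStipsiczGSM1999]
* A. Akhmedov, B. D. Park, *Exotic smooth structures on small 4-manifolds with odd signatures*,
  Invent. Math. 181 (2010) 577–603, §§2, 4, 9 (Lemma 8). [AkhmedovPark2010]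
-/

noncomputable section

open scoped Manifold ContDiff Topology
open Set Function CategoryTheory Topology
open Literature.AlgebraicTopology.SingularHomology

namespace Literature.Topology.FourManifolds

universe u

/-! ### Transport of local generators along homeomorphisms -/

/-- A homeomorphism carries a class which is a local generator at `x` to a class which is a local
generator at the image point (local homology is natural and invariant under homeomorphisms;
Hatcher 2002, §3.3 p. 231). [cite: HatcherAT2002, §3.3 p. 231] -/
theorem exists_linearEquiv_toLocal_map_homeomorph {X Y : Type u} [TopologicalSpace X]
    [TopologicalSpace Y] [T1Space Y] (e : X ≃ₜ Y) {n : ℕ} (a : singularHomology ℤ ℤ X n) (x : X)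
    (ha : ∃ f : localHomology ℤ ℤ X x n ≃ₗ[ℤ] ℤ, f (singularHomology.toLocal ℤ ℤ x n a) = 1) :
    ∃ f : localHomology ℤ ℤ Y (e x) n ≃ₗ[ℤ] ℤ,
      f (singularHomology.toLocal ℤ ℤ (e x) n (singularHomology.map ℤ ℤ (e : C(X, Y)) n a)) = 1 := by
  have hmaps : MapsTo (e : C(X, Y)) ({x}ᶜ : Set X) ({e x}ᶜ : Set Y) :=
    fun y hy h => hy (e.injective h)
  rw [singularHomology.toLocal_map_apply ℤ ℤ (e : C(X, Y)) x (e x) hmaps n]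
  haveI := localHomology.isIso_map_of_isOpenEmbedding ℤ ℤ (e : C(X, Y)) e.isOpenEmbedding x hmaps n
  exact (exists_linearEquiv_apply_eq_one_iff_of_isIso _ _).2 ha

namespace BoundaryGluingData

variable {m : ℕ}
variable {S : Type} [TopologicalSpace S] [ChartedSpace (EuclideanSpace ℝ (Fin (m + 1))) S]
  [IsManifold (𝓡 (m + 1)) ∞ S]
variable {S' : Type} [TopologicalSpace S'] [ChartedSpace (EuclideanSpace ℝ (Fin (m + 1))) S']
  [IsManifold (𝓡 (m + 1)) ∞ S']
variable {cM : NullCobordism (m + 1) S} {cN : NullCobordism (m + 1) S'} {φ : S ≃ S'}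
variable {P : Type} [TopologicalSpace P] [ChartedSpace (EuclideanSpace ℝ (Fin (m + 1 + 1))) P]
  [IsManifold (𝓡 (m + 1 + 1)) ∞ P]
variable (G : BoundaryGluingData cM.boundaryData cN.boundaryData φ P)

include G

/-! ### The identification of the boundaries is a homeomorphism -/

omit [IsManifold (𝓡 (m + 1 + 1)) ∞ P] in
/-- The identification `φ` of the boundaries underlying a gluing datum is continuous: after the
embedding `incl_M` it is `jA⁻¹ ∘ jB ∘ incl_N`. [folklore] -/
theorem continuous_φ_symm [Nonempty S] : Continuous φ.symm := by
  haveI : Nonempty cM.W := ⟨cM.incl (Classical.arbitrary S)⟩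
  have h1 : Continuous (cM.incl ∘ φ.symm) := by
    have heq : cM.incl ∘ φ.symm = G.invA ∘ G.jB ∘ cN.incl := by
      funext w
      show cM.incl (φ.symm w) = G.invA (G.jB (cN.boundaryData.incl w))
      rw [G.jB_incl w]
      exact (G.invA_jA _).symm
    rw [heq]
    exact G.continuousOn_invA.comp_continuous (G.continuous_jB.comp cN.continuous_incl)
      fun w => ⟨cM.boundaryData.incl (φ.symm w), (G.jB_incl w).symm⟩
  exact (cM.isSmoothEmbedding_incl.isEmbedding.continuous_iff).2 h1

omit [IsManifold (𝓡 (m + 1 + 1)) ∞ P] in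
/-- The identification `φ` of the boundaries underlying a gluing datum is continuous. [folklore] -/
theorem continuous_φ [Nonempty S'] : Continuous φ := by
  have h := G.symm.continuous_φ_symm
  simpa using h

/-! ### `P` is connected -/

omit [IsManifold (𝓡 (m + 1 + 1)) ∞ P] in
/-- A gluing of two connected pieces along a nonempty boundary is connected. [folklore] -/
theorem connectedSpace [ConnectedSpace cM.W] [ConnectedSpace cN.W] [Nonempty S] :
    ConnectedSpace P := by
  have hA : IsConnected (range G.jA) := isConnected_range G.continuous_jA
  have hB : IsConnected (range G.jB) := isConnected_range G.continuous_jB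
  have hne : (range G.jA ∩ range G.jB).Nonempty := by
    obtain ⟨s⟩ := (inferInstance : Nonempty S)
    exact ⟨G.jA (cM.boundaryData.incl s), mem_range_self _,
      ⟨cN.boundaryData.incl (φ s), (G.jA_incl s).symm⟩⟩
  have huniv : IsConnected (univ : Set P) := by
    rw [← G.range_union]
    exact hA.union hne hB
  exact connectedSpace_iff_univ.2 huniv

/-! ### The main theorem -/

/-- **A closed manifold glued from two oriented pieces along a connected nonempty boundary is
`ℤ`-orientable.**  Let `P = M ∪_φ N` (`G : BoundaryGluingData`) be a closed connected
`(m+2)`-manifold glued from compact `(m+2)`-manifolds with boundary `M = cM.W`, `N = cN.W` along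
their whole boundaries `S ≅ ∂M`, `S' ≅ ∂N`, with `S` connected and nonempty, and let
`z_M ∈ Hₘ₊₂(M, ∂M; ℤ)`, `z_N ∈ Hₘ₊₂(N, ∂N; ℤ)` be relative fundamental classes.  Then `P` is
`ℤ`-orientable.  (Proof in the module docstring: `jB_* z_N ∈ Hₘ₊₂(P, jA M)` is nonzero with zero
boundary, hence lifts to a nonzero class of `Hₘ₊₂(P; ℤ)`; Hatcher Thm. 3.26(b).)
[cite: HatcherAT2002, §3.3 Thm. 3.26(b), p. 253 and Exercises 31–32] [cite: Spanier1981, Ch. 6 Sec. 3 Cor. 10] -/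
theorem isOrientableOver_int_of_isRelFundamentalClass [CompactSpace S] [T2Space S] [Nonempty S]
    [ConnectedSpace S] [CompactSpace S'] [T2Space S'] [Nonempty S'] [CompactSpace P] [T2Space P]
    [ConnectedSpace P]
    {zM : relativeSingularHomology ℤ ℤ cM.W ((𝓡∂ (m + 1 + 1)).boundary cM.W) (m + 1 + 1)}
    (hzM : IsRelFundamentalClass ℤ ((𝓡∂ (m + 1 + 1)).boundary cM.W) zM)
    {zN : relativeSingularHomology ℤ ℤ cN.W ((𝓡∂ (m + 1 + 1)).boundary cN.W) (m + 1 + 1)}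
    (hzN : IsRelFundamentalClass ℤ ((𝓡∂ (m + 1 + 1)).boundary cN.W) zN) :
    IsOrientableOver ℤ P (m + 1 + 1) := by
  have hn : m + 1 ≠ 0 := Nat.succ_ne_zero m
  -- the boundaries as closed connected manifolds
  letI : ChartedSpace (EuclideanSpace ℝ (Fin (m + 1))) ↥((𝓡∂ (m + 1 + 1)).boundary cM.W) :=
    boundaryTopChartedSpace (n := m + 1) (W := cM.W)
  haveI : CompactSpace ↥((𝓡∂ (m + 1 + 1)).boundary cM.W) :=
    isCompact_iff_compactSpace.1 (isCompact_boundary (n := m + 1))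
  haveI : ConnectedSpace ↥((𝓡∂ (m + 1 + 1)).boundary cM.W) :=
    cM.inclHomeomorph.surjective.connectedSpace cM.inclHomeomorph.continuous
  haveI : Nonempty ↥((𝓡∂ (m + 1 + 1)).boundary cN.W) :=
    ⟨cN.inclHomeomorph (Classical.arbitrary S')⟩
  -- the homeomorphism `∂N ≅ ∂M` of the seam, `ψ = incl_M ∘ φ⁻¹ ∘ incl_N⁻¹`
  let φₜ : S ≃ₜ S' :=
    { toEquiv := φ
      continuous_toFun := G.continuous_φ
      continuous_invFun := G.continuous_φ_symm }
  let ψ : ↥((𝓡∂ (m + 1 + 1)).boundary cN.W) ≃ₜ ↥((𝓡∂ (m + 1 + 1)).boundary cM.W) :=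
    cN.inclHomeomorph.symm.trans (φₜ.symm.trans cM.inclHomeomorph)
  have hψ : ∀ w : ↥((𝓡∂ (m + 1 + 1)).boundary cN.W), G.jA (ψ w).1 = G.jB w.1 := by
    intro w
    obtain ⟨s', rfl⟩ := cN.inclHomeomorph.surjective w
    show G.jA (cM.incl (φ.symm (cN.inclHomeomorph.symm (cN.inclHomeomorph s')))) =
      G.jB (cN.incl s')
    rw [Homeomorph.symm_apply_apply]
    exact (G.jB_incl s').symm
  -- the maps of the square `∂N → ∂M → M → jA M`
  let jBc : C(cN.W, P) := ⟨G.jB, G.continuous_jB⟩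
  let rA : C(cM.W, ↥(range G.jA)) :=
    ⟨fun a => ⟨G.jA a, mem_range_self a⟩, G.continuous_jA.subtype_mk _⟩
  let valM : C(↥((𝓡∂ (m + 1 + 1)).boundary cM.W), cM.W) := ⟨Subtype.val, continuous_subtype_val⟩
  have hfac : subsetRestrict jBc G.mapsTo_jB_boundary =
      rA.comp (valM.comp (ψ : C(↥((𝓡∂ (m + 1 + 1)).boundary cN.W),
        ↥((𝓡∂ (m + 1 + 1)).boundary cM.W)))) := by
    ext w
    exact (hψ w).symm
  -- `z_N ≠ 0`, hence `b = jB_* z_N ≠ 0`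
  have hzN0 : zN ≠ 0 := by
    haveI : Nonempty cN.W := ⟨cN.incl (Classical.arbitrary S')⟩
    obtain ⟨y, hy⟩ := interior_nonempty (I := 𝓡∂ (m + 1 + 1)) (M := cN.W)
    have hyB : y ∈ ((𝓡∂ (m + 1 + 1)).boundary cN.W)ᶜ := by
      rwa [ModelWithCorners.compl_boundary]
    obtain ⟨e, he⟩ := hzN ⟨y, hyB⟩
    intro h0
    rw [h0, map_zero, map_zero] at he
    exact zero_ne_one he
  have hb0 : relativeSingularHomology.map ℤ ℤ jBc G.mapsTo_jB_boundary (m + 1 + 1) zN ≠ 0 := by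
    haveI := G.isIso_map_jB_boundary' ℤ ℤ (m + 1 + 1)
    intro h0
    apply hzN0
    have h1 : (relativeSingularHomology.map ℤ ℤ jBc G.mapsTo_jB_boundary (m + 1 + 1) ≫
        inv (relativeSingularHomology.map ℤ ℤ jBc G.mapsTo_jB_boundary (m + 1 + 1))) zN = 0 := by
      rw [ModuleCat.comp_apply]
      erw [h0]
      rw [map_zero]
    rwa [IsIso.hom_inv_id, ModuleCat.id_apply] at h1
  -- `∂b = 0`
  have hδ : relativeSingularHomology.δ ℤ ℤ P (range G.jA) (m + 1)
      (relativeSingularHomology.map ℤ ℤ jBc G.mapsTo_jB_boundary (m + 1 + 1) zN) = 0 := by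
    -- naturality of `∂`
    have hnat := relativeSingularHomology.δ_naturality ℤ ℤ jBc G.mapsTo_jB_boundary (m + 1)
    have h1 : relativeSingularHomology.δ ℤ ℤ P (range G.jA) (m + 1)
        (relativeSingularHomology.map ℤ ℤ jBc G.mapsTo_jB_boundary (m + 1 + 1) zN) =
        singularHomology.map ℤ ℤ (subsetRestrict jBc G.mapsTo_jB_boundary) (m + 1)
          (relativeSingularHomology.δ ℤ ℤ cN.W ((𝓡∂ (m + 1 + 1)).boundary cN.W) (m + 1) zN) := by
      rw [← ModuleCat.comp_apply, ← hnat, ModuleCat.comp_apply]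
    -- the transported boundary class `u` is `± ∂z_M`
    have hugen := exists_linearEquiv_toLocal_map_homeomorph ψ
      (relativeSingularHomology.δ ℤ ℤ cN.W ((𝓡∂ (m + 1 + 1)).boundary cN.W) (m + 1) zN)
      (Classical.arbitrary _)
      (isGenerator_toLocal_δ_of_isRelFundamentalClass' ℤ hn hzN (Classical.arbitrary _))
    have hupm := eq_fundamentalClass_or_eq_neg_of_isGenerator_toLocal
      (boundaryOrientation ℤ hn hzM) _ _ hugen
    rw [boundaryOrientation_fundamentalClass_eq ℤ hn hzM] at hupm
    -- `∂z_M ↦ 0` in `Hₘ₊₁(M)`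
    have hvan : singularHomology.map ℤ ℤ valM (m + 1)
        (relativeSingularHomology.δ ℤ ℤ cM.W ((𝓡∂ (m + 1 + 1)).boundary cM.W) (m + 1) zM) = 0 := by
      rw [← ModuleCat.comp_apply, relativeSingularHomology.δ_comp_map]
      rfl
    rw [h1, hfac, singularHomology.map_comp, singularHomology.map_comp, ModuleCat.comp_apply,
      ModuleCat.comp_apply]
    rcases hupm with h | h
    · rw [h, hvan, map_zero]
    · rw [h, map_neg, hvan, neg_zero, map_zero]
  -- lift `b` to a (nonzero) class of `Hₘ₊₂(P)`
  have hex := relativeSingularHomology.exact_ofAbsolute_δ ℤ ℤ (X := P) (range G.jA) (m + 1)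
  rw [ShortComplex.moduleCat_exact_iff] at hex
  obtain ⟨w, hw⟩ := hex _ hδ
  have hw0 : w ≠ 0 := by
    rintro rfl
    apply hb0
    erw [← hw]
    rw [map_zero]
  exact isOrientableOver_int_of_ne_zero hw0

/-- **The same from smooth orientations of the pieces** (Bredon VI.7.15: a smooth orientation of
a compact manifold with boundary integrates to a relative fundamental class, the tree's
`NullCobordism.exists_isRelFundamentalClass_of_smoothOrientation`). [cite: Bredon1993, VI.7.15] [cite: HatcherAT2002, §3.3 Thm. 3.26(b)] -/
theorem isOrientableOver_int_of_smoothOrientation [CompactSpace S] [T2Space S] [Nonempty S]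
    [ConnectedSpace S] [CompactSpace S'] [T2Space S'] [Nonempty S'] [CompactSpace P] [T2Space P]
    [ConnectedSpace P] (oM : SmoothOrientation (𝓡∂ (m + 1 + 1)) cM.W)
    (oN : SmoothOrientation (𝓡∂ (m + 1 + 1)) cN.W) : IsOrientableOver ℤ P (m + 1 + 1) := by
  obtain ⟨zM, hzM⟩ := cM.exists_isRelFundamentalClass_of_smoothOrientation oM
  obtain ⟨zN, hzN⟩ := cN.exists_isRelFundamentalClass_of_smoothOrientation oN
  exact G.isOrientableOver_int_of_isRelFundamentalClass hzM hzN

/-- **The same from smooth orientability of the pieces.** [cite: Bredon1993, VI.7.15] [cite: HatcherAT2002, §3.3 Thm. 3.26(b)] -/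
theorem isOrientableOver_int_of_isOrientable [CompactSpace S] [T2Space S] [Nonempty S]
    [ConnectedSpace S] [CompactSpace S'] [T2Space S'] [Nonempty S'] [CompactSpace P] [T2Space P]
    [ConnectedSpace P] (hM : IsOrientable (𝓡∂ (m + 1 + 1)) cM.W)
    (hN : IsOrientable (𝓡∂ (m + 1 + 1)) cN.W) : IsOrientableOver ℤ P (m + 1 + 1) :=
  G.isOrientableOver_int_of_smoothOrientation hM.some hN.some

end BoundaryGluingData

/-! ### In tube coordinates: surgery along `F`, torus surgery, fibre sum -/

section Tube

variable {Y : Type} [TopologicalSpace Y] [T2Space Y] [SecondCountableTopology Y] [CompactSpace Y]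
  [ConnectedSpace Y] [ChartedSpace (EuclideanSpace ℝ (Fin 4)) Y] [IsManifold (𝓡 4) ∞ Y]
  {F : Type} [TopologicalSpace F] [ConnectedSpace F]
  {T : F × EuclideanSpace ℝ (Fin 2) → Y} {g : Y → ℝ}

omit [T2Space Y] [SecondCountableTopology Y] [CompactSpace Y] [ConnectedSpace Y] in
/-- The boundary of the complement `{¼ ≤ g}` of a codimension-two tube in a closed manifold is
connected: it is the level `{g = ¼} ≅ F × S¹` (`nonempty_boundary_regularSuperlevel_homeomorph_level`,
`nonempty_level_homeomorph_prod_addCircle`). [folklore] -/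
theorem connectedSpace_boundary_regularSuperlevel_tube (hT : Topology.IsEmbedding T)
    (hreg : IsRegularLevel (𝓡 4) g (1 / 4)) (hle : ∀ x, g (T x) ≤ 1 / 4 ↔ ‖x.2‖ ≤ 1 / 2)
    (hlt : ∀ x, g (T x) < 1 / 4 ↔ ‖x.2‖ < 1 / 2) (hout : ∀ y, y ∉ range T → g y = 1) :
    ConnectedSpace ↥((𝓡∂ 4).boundary (RegularSuperlevel hreg)) := by
  obtain ⟨e₁⟩ := nonempty_boundary_regularSuperlevel_homeomorph_level (k := 3) hreg
  obtain ⟨e₂⟩ := nonempty_level_homeomorph_prod_addCircle hT hle hlt hout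
  haveI : ConnectedSpace (AddCircle (1 : ℝ)) :=
    (QuotientAddGroup.mk_surjective).connectedSpace continuous_quotient_mk'
  exact (e₁.trans e₂).symm.surjective.connectedSpace (e₁.trans e₂).symm.continuous

/-- **Surgery along `F` on an orientable manifold gives an orientable manifold** (torus surgery
for `F = T²`: Gompf–Stipsicz 1999, §8.3 p. 311; the surgeries of Akhmedov–Park 2010, §§2, 4).
Let `Y` be a closed connected ORIENTABLE smooth `4`-manifold, `T : F × ℝ² → Y` a topological
embedding with a tube function `g` (`TubularSplitting.lean`, `exists_tube_function`), `F`
connected, and let `P` be any closed smooth `4`-manifold which is a boundary gluing of the tube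
complement `M = {¼ ≤ g}` with a connected, smoothly orientable compact piece `N'` (for a torus
surgery: `N' = T² × D²`, glued back by a diffeomorphism of `T³`).  Then `P` is `ℤ`-orientable:
`M` is orientable as a regular sublevel manifold of the orientable `Y`
(`RegularSublevel.isOrientable`; `ℤ`-orientable = smoothly orientable for Hausdorff manifolds,
`isOrientable_of_isOrientableOver_int`), its boundary `≅ F × S¹` is connected, and
`BoundaryGluingData.isOrientableOver_int_of_isOrientable` applies. [cite: GompfStipsiczGSM1999, §8.3 p. 311] [cite: HatcherAT2002, §3.3 Thm. 3.26(b)] -/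
theorem isOrientableOver_int_of_tube_surgery (hT : Topology.IsEmbedding T)
    (hreg : IsRegularLevel (𝓡 4) g (1 / 4)) (hle : ∀ x, g (T x) ≤ 1 / 4 ↔ ‖x.2‖ ≤ 1 / 2)
    (hlt : ∀ x, g (T x) < 1 / 4 ↔ ‖x.2‖ < 1 / 2) (hout : ∀ y, y ∉ range T → g y = 1)
    (hY : IsOrientableOver ℤ Y 4)
    {S' : Type} [TopologicalSpace S'] [ChartedSpace (EuclideanSpace ℝ (Fin 3)) S']
    [IsManifold (𝓡 3) ∞ S'] [CompactSpace S'] [Nonempty S'] [T2Space S'] (cN' : NullCobordism 3 S')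
    [ConnectedSpace cN'.W] (hN' : IsOrientable (𝓡∂ 4) cN'.W)
    {P : Type} [TopologicalSpace P] [T2Space P] [CompactSpace P]
    [ChartedSpace (EuclideanSpace ℝ (Fin 4)) P] [IsManifold (𝓡 4) ∞ P]
    {φ : (RegularSublevel.boundaryData hreg.const_sub).carrier ≃ S'}
    (GP : BoundaryGluingData (RegularSublevel.boundaryData hreg.const_sub) cN'.boundaryData φ P) :
    IsOrientableOver ℤ P 4 := by
  haveI : Nonempty F := ConnectedSpace.toNonempty
  -- the tube complement as a null-cobordism of its boundary
  let bM := RegularSublevel.boundaryData hreg.const_sub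
  let cM : NullCobordism 3 bM.carrier :=
    { W := RegularSuperlevel hreg
      incl := bM.incl
      isSmoothEmbedding_incl := bM.isSmoothEmbedding
      range_incl := bM.range_incl }
  -- its boundary is nonempty, compact, Hausdorff and connected (the level `≅ F × S¹`)
  have hlevel : (g ⁻¹' {1 / 4}).Nonempty := by
    rw [level_eq_image_tube hle hlt hout]
    obtain ⟨v, hv⟩ : (Metric.sphere (0 : EuclideanSpace ℝ (Fin 2)) (1 / 2)).Nonempty :=
      (NormedSpace.sphere_nonempty).2 (by norm_num)
    exact ⟨T (Classical.arbitrary F, v), (Classical.arbitrary F, v), ⟨mem_univ _, hv⟩, rfl⟩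
  obtain ⟨y₀, hy₀⟩ := hlevel
  simp only [mem_preimage, mem_singleton_iff] at hy₀
  haveI : Nonempty bM.carrier :=
    ⟨⟨RegularSublevel.mk hreg.const_sub y₀ (by show 1 / 4 - g y₀ ≤ 0; rw [hy₀]; norm_num),
      (RegularSublevel.mem_boundary_iff hreg.const_sub _).2
        (by show 1 / 4 - g y₀ = 0; rw [hy₀]; norm_num)⟩⟩
  haveI : CompactSpace bM.carrier := by
    haveI : CompactSpace ↥((𝓡∂ 4).boundary (RegularSuperlevel hreg)) :=
      isCompact_iff_compactSpace.1 (isCompact_boundary (n := 3) (W := RegularSuperlevel hreg))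
    exact this
  haveI : T2Space bM.carrier :=
    inferInstanceAs (T2Space ↥((𝓡∂ 4).boundary (RegularSuperlevel hreg)))
  haveI : ConnectedSpace bM.carrier := by
    haveI := connectedSpace_boundary_regularSuperlevel_tube hT hreg hle hlt hout
    exact this
  -- the complement is connected and orientable
  haveI : ConnectedSpace cM.W :=
    connectedSpace_regularSuperlevel_tube (le_refl 2) hT.continuous hreg hle hlt hout
  have hM : IsOrientable (𝓡∂ 4) cM.W :=
    RegularSublevel.isOrientable hreg.const_sub (isOrientable_of_isOrientableOver_int Y hY)
  -- `P` is connected, and orientable by the main theorem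
  let GP' : BoundaryGluingData cM.boundaryData cN'.boundaryData φ P := GP
  haveI : ConnectedSpace P := GP'.connectedSpace
  exact GP'.isOrientableOver_int_of_isOrientable hM hN'

/-- **Torus surgery preserves orientability** (regluing the tube piece): with `Y`, `T`, `g` as
in `isOrientableOver_int_of_tube_surgery`, every closed smooth `4`-manifold `P` which is a boundary
gluing of the tube complement `{¼ ≤ g}` with the tube piece `{g ≤ ¼} ≅ F × D̄²` itself, along ANY
identification `φ'` of the boundaries (for `F = T²`: a torus surgery / logarithmic
transformation, Gompf–Stipsicz 1999 §8.3; the Luttinger and `m`-torus surgeries of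
Akhmedov–Park 2010, §§2, 4, 9, producing `Y₁(1,1)` from `Σ₂ × T²` and `Z''(1,m)` from
`T⁴ # ℂℙ²bar`), is `ℤ`-orientable. [cite: GompfStipsiczGSM1999, §8.3 p. 311] [cite: AkhmedovPark2010, §§2, 4] -/
theorem isOrientableOver_int_of_tube_regluing (hT : Topology.IsEmbedding T)
    (hreg : IsRegularLevel (𝓡 4) g (1 / 4)) (hle : ∀ x, g (T x) ≤ 1 / 4 ↔ ‖x.2‖ ≤ 1 / 2)
    (hlt : ∀ x, g (T x) < 1 / 4 ↔ ‖x.2‖ < 1 / 2) (hout : ∀ y, y ∉ range T → g y = 1)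
    (hY : IsOrientableOver ℤ Y 4)
    {P : Type} [TopologicalSpace P] [T2Space P] [CompactSpace P]
    [ChartedSpace (EuclideanSpace ℝ (Fin 4)) P] [IsManifold (𝓡 4) ∞ P]
    {φ' : (RegularSublevel.boundaryData hreg.const_sub).carrier ≃
      (RegularSublevel.boundaryData hreg).carrier}
    (GP : BoundaryGluingData (RegularSublevel.boundaryData hreg.const_sub)
      (RegularSublevel.boundaryData hreg) φ' P) :
    IsOrientableOver ℤ P 4 := by
  haveI : Nonempty F := ConnectedSpace.toNonempty
  let bN := RegularSublevel.boundaryData hreg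
  let cN : NullCobordism 3 bN.carrier :=
    { W := RegularSublevel hreg
      incl := bN.incl
      isSmoothEmbedding_incl := bN.isSmoothEmbedding
      range_incl := bN.range_incl }
  have hlevel : (g ⁻¹' {1 / 4}).Nonempty := by
    rw [level_eq_image_tube hle hlt hout]
    obtain ⟨v, hv⟩ : (Metric.sphere (0 : EuclideanSpace ℝ (Fin 2)) (1 / 2)).Nonempty :=
      (NormedSpace.sphere_nonempty).2 (by norm_num)
    exact ⟨T (Classical.arbitrary F, v), (Classical.arbitrary F, v), ⟨mem_univ _, hv⟩, rfl⟩
  obtain ⟨y₀, hy₀⟩ := hlevel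
  simp only [mem_preimage, mem_singleton_iff] at hy₀
  haveI : Nonempty bN.carrier :=
    ⟨⟨RegularSublevel.mk hreg y₀ hy₀.le, (RegularSublevel.mem_boundary_iff hreg _).2 hy₀⟩⟩
  haveI : CompactSpace bN.carrier := by
    haveI : CompactSpace ↥((𝓡∂ 4).boundary (RegularSublevel hreg)) :=
      isCompact_iff_compactSpace.1 (isCompact_boundary (n := 3) (W := RegularSublevel hreg))
    exact this
  haveI : T2Space bN.carrier := inferInstanceAs (T2Space ↥((𝓡∂ 4).boundary (RegularSublevel hreg)))
  -- the tube piece is connected (its interior `≅ F × ℝ²` is dense) and orientable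
  haveI : ConnectedSpace cN.W := by
    have hpre : IsConnected (g ⁻¹' Iic (1 / 4)) := by
      rw [preimage_Iic_eq_image_tube hle hout]
      have hset : {x : F × EuclideanSpace ℝ (Fin 2) | ‖x.2‖ ≤ 1 / 2} =
          (univ : Set F) ×ˢ Metric.closedBall (0 : EuclideanSpace ℝ (Fin 2)) (1 / 2) := by
        ext x
        simp
      rw [hset]
      refine (isConnected_univ.prod (Metric.isConnected_closedBall ?_)).image _
        hT.continuous.continuousOn
      norm_num
    haveI : ConnectedSpace ↥(g ⁻¹' Iic (1 / 4)) := isConnected_iff_connectedSpace.1 hpre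
    exact this
  have hN : IsOrientable (𝓡∂ 4) cN.W :=
    RegularSublevel.isOrientable hreg (isOrientable_of_isOrientableOver_int Y hY)
  exact isOrientableOver_int_of_tube_surgery hT hreg hle hlt hout hY cN hN
    (GP : BoundaryGluingData _ cN.boundaryData φ' P)

/-- **The generalised fibre sum of two orientable closed `4`-manifolds is orientable.**  Let
`Y₁`, `Y₂` be closed connected orientable smooth `4`-manifolds with tubes `Tᵢ : Fᵢ × ℝ² → Yᵢ`
(`Fᵢ` connected) and tube functions `gᵢ`, and let `P` be any closed smooth `4`-manifold which is
a boundary gluing of the two tube complements `{¼ ≤ g₁}`, `{¼ ≤ g₂}` along any identification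
of the boundaries `Fᵢ × S¹` (the normal connected sum `Y₁ #_ψ Y₂` of Gompf 1995 / Akhmedov–Park
2010, §9, "`X₁(m) = Y₁(1,1) #_ψ Z''(1,m)`").  Then `P` is `ℤ`-orientable. [cite: AkhmedovPark2010, §9] [cite: HatcherAT2002, §3.3 Thm. 3.26(b)] -/
theorem isOrientableOver_int_of_tube_fibreSum (hT : Topology.IsEmbedding T)
    (hreg : IsRegularLevel (𝓡 4) g (1 / 4)) (hle : ∀ x, g (T x) ≤ 1 / 4 ↔ ‖x.2‖ ≤ 1 / 2)
    (hlt : ∀ x, g (T x) < 1 / 4 ↔ ‖x.2‖ < 1 / 2) (hout : ∀ y, y ∉ range T → g y = 1)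
    (hY : IsOrientableOver ℤ Y 4)
    {Y₂ : Type} [TopologicalSpace Y₂] [T2Space Y₂] [SecondCountableTopology Y₂] [CompactSpace Y₂]
    [ConnectedSpace Y₂] [ChartedSpace (EuclideanSpace ℝ (Fin 4)) Y₂] [IsManifold (𝓡 4) ∞ Y₂]
    {F₂ : Type} [TopologicalSpace F₂] [ConnectedSpace F₂]
    {T₂ : F₂ × EuclideanSpace ℝ (Fin 2) → Y₂} {g₂ : Y₂ → ℝ} (hT₂ : Topology.IsEmbedding T₂)
    (hreg₂ : IsRegularLevel (𝓡 4) g₂ (1 / 4)) (hle₂ : ∀ x, g₂ (T₂ x) ≤ 1 / 4 ↔ ‖x.2‖ ≤ 1 / 2)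
    (hlt₂ : ∀ x, g₂ (T₂ x) < 1 / 4 ↔ ‖x.2‖ < 1 / 2) (hout₂ : ∀ y, y ∉ range T₂ → g₂ y = 1)
    (hY₂ : IsOrientableOver ℤ Y₂ 4)
    {P : Type} [TopologicalSpace P] [T2Space P] [CompactSpace P]
    [ChartedSpace (EuclideanSpace ℝ (Fin 4)) P] [IsManifold (𝓡 4) ∞ P]
    {ψ : (RegularSublevel.boundaryData hreg.const_sub).carrier ≃
      (RegularSublevel.boundaryData hreg₂.const_sub).carrier}
    (GP : BoundaryGluingData (RegularSublevel.boundaryData hreg.const_sub)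
      (RegularSublevel.boundaryData hreg₂.const_sub) ψ P) :
    IsOrientableOver ℤ P 4 := by
  haveI : Nonempty F₂ := ConnectedSpace.toNonempty
  let bM₂ := RegularSublevel.boundaryData hreg₂.const_sub
  let cM₂ : NullCobordism 3 bM₂.carrier :=
    { W := RegularSuperlevel hreg₂
      incl := bM₂.incl
      isSmoothEmbedding_incl := bM₂.isSmoothEmbedding
      range_incl := bM₂.range_incl }
  have hlevel : (g₂ ⁻¹' {1 / 4}).Nonempty := by
    rw [level_eq_image_tube hle₂ hlt₂ hout₂]
    obtain ⟨v, hv⟩ : (Metric.sphere (0 : EuclideanSpace ℝ (Fin 2)) (1 / 2)).Nonempty :=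
      (NormedSpace.sphere_nonempty).2 (by norm_num)
    exact ⟨T₂ (Classical.arbitrary F₂, v), (Classical.arbitrary F₂, v), ⟨mem_univ _, hv⟩, rfl⟩
  obtain ⟨y₀, hy₀⟩ := hlevel
  simp only [mem_preimage, mem_singleton_iff] at hy₀
  haveI : Nonempty bM₂.carrier :=
    ⟨⟨RegularSublevel.mk hreg₂.const_sub y₀ (by show 1 / 4 - g₂ y₀ ≤ 0; rw [hy₀]; norm_num),
      (RegularSublevel.mem_boundary_iff hreg₂.const_sub _).2
        (by show 1 / 4 - g₂ y₀ = 0; rw [hy₀]; norm_num)⟩⟩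
  haveI : CompactSpace bM₂.carrier := by
    haveI : CompactSpace ↥((𝓡∂ 4).boundary (RegularSuperlevel hreg₂)) :=
      isCompact_iff_compactSpace.1 (isCompact_boundary (n := 3) (W := RegularSuperlevel hreg₂))
    exact this
  haveI : T2Space bM₂.carrier :=
    inferInstanceAs (T2Space ↥((𝓡∂ 4).boundary (RegularSuperlevel hreg₂)))
  haveI : ConnectedSpace cM₂.W :=
    connectedSpace_regularSuperlevel_tube (le_refl 2) hT₂.continuous hreg₂ hle₂ hlt₂ hout₂
  have hM₂ : IsOrientable (𝓡∂ 4) cM₂.W :=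
    RegularSublevel.isOrientable hreg₂.const_sub (isOrientable_of_isOrientableOver_int Y₂ hY₂)
  exact isOrientableOver_int_of_tube_surgery hT hreg hle hlt hout hY cM₂ hM₂
    (GP : BoundaryGluingData _ cM₂.boundaryData ψ P)

end Tube

end Literature.Topology.FourManifolds

end
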